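import Summits.HodgeConjecture.HodgeConjecture.Theorems.WeilTypeLadderFermatTransfer
import HarnessLib

/-!
# WeilTypeLadder · the Fermat transfer with SEVERAL maps to the Fermat variety (multi-domination form),
# and the R3-shaped body it serves (CM fields `ℚ(ζ_m)`, `[K:ℚ] > 2`, where one map does not suffice)

b2b cell `hweil` (packet `run/shared/lean/b2b/hodge-weil/`, report `b2b-hweil-pv3-g38/KERNEL-TRANSFER.md` §7
ADDENDUM A, PROPOSITION T_m). Companion of `Theorems/WeilTypeLadderFermatTransfer` (single map `b : T ⟶ X`).

Why several maps. For the primitive Prym `B` of a Weil-type `ℤ/m`-cover `C → ℙ¹` with `N = h + 2` branch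
points, `dim B = φ(m)·h/2`; the Abel–Prym sum on `h` points `Cʰ → B` is dominant only when `φ(m) = 2`
(`m ∈ {3,4,6}`). For `φ(m) > 2` (the CM-field rung R3, `E = ℚ(ζ_m)`) the packet's PROPOSITION T_m uses
`κ·h = dim B` points (`κ = φ(m)/2`): `a₁ : C^{κh} → B`, `(Pⱼ) ↦ e(Σⱼ AJ(Pⱼ))`, IS dominant, and
`a₁^*(W_E ⊗ ℂ) ⊆ Σ_S pr_S^*(U ⊗ ℂ)` over the `h`-subsets `S` of the `κh` factors; on a resolution `T` of a
dominant component of the fibre product over `C^{κh}` of the pulled-back Fermat quotients one gets maps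
`b_S : T ⟶ Xʰₘ` with `p^* pr_S^* U = b_S^* M`, hence **`a^* c ∈ Σ_S b_S^*(M ⊗ ℂ)`** — a SUM of pull-backs along
finitely many maps to the Fermat variety. This file proves that this weaker hypothesis still forces
algebraicity:

* `mem_algebraicClasses_of_fermatTransferFamily` — `X = Xᵏₘ` smooth projective Fermat, `m` prime or
  `1 < m ≤ 20`; `Z`, `T` smooth projective of the same dimension; `a : T ⟶ Z` surjective; `b : ι → (T ⟶ X)`
  ANY family of morphisms; if `a^* c ∈ ⨆ᵢ (bᵢ)^*(span of the rational (p,p)-classes of X)` then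
  `c ∈ algebraicClasses Z p` (Shioda per generator, Fulton per `bᵢ`, `iSup_le`, degree trick). PROVED from
  the two refereed named facts `hodgeClasses_algebraic_fermat`, `fulton1998_map_mem_algebraicClasses`.
* `abelianVariety_mem_algebraicClasses_of_fermatTransferFamily` — `Z = A` an abelian variety.
* `weilClassesCMField_fermatTransferFamily_of_facts` / `_of_weilClassesCMField` / `_of_hodgeConjecture` —
  the body of R3 (`WeilClassesCMField`, rung binders first and verbatim), then a multi-datum
  `(μ, k, X = Xᵏ_μ, T, a, ι, b)`, then for every class of `weilClassesField A φ P (2m′)` whose pull-back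
  `a^* c` lies in `⨆ᵢ (bᵢ)^*(span …)`: rational of type `(m′,m′)` ⇒ algebraic — from the facts; from the
  rung (datum unused); ON-PATH from `HodgeConjecture`.

HONEST LABEL: which abelian varieties carry a multi-datum is NOT decided in the kernel (PROPOSITION T_m,
pen-and-paper, packet: the primitive Pryms of every Weil-type `ℤ/m`-cover of `ℙ¹`, `m` prime or `≤ 20`);
sub-families, not general members; 0 unconditional rungs added; conditional on [Shioda 1979] +
[Fulton 1998, Cor. 19.2 (b)] (refereed) and on the datum; Markman-free. No `sorry`, no new definition,
no new named fact.
-/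

noncomputable section

-- every declaration of this problem lives in `Summit.HodgeConjecture.HodgeConjecture.…` (summit = sub-problem)
set_option linter.dupNamespace false

open CategoryTheory
open Literature.AlgebraicGeometry Literature.AlgebraicGeometry.Motives
open Literature.AlgebraicGeometry.HodgeTheory
open Literature.AlgebraicTopology.SingularHomology

namespace Summit.HodgeConjecture.HodgeConjecture.WeilTypeLadder

/-! ### §1 The multi-domination principle -/

section Principle

universe u

variable {k m z p : ℕ} {X T Z : Motives.SchemeOver ℂ} {ι : Type u}

/-- **The Fermat transfer principle with several maps to the Fermat variety.** `X = Xᵏₘ` smooth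
projective Fermat with `m` prime or `1 < m ≤ 20`; `Z`, `T` smooth projective of the same dimension `z`;
`a : T ⟶ Z` surjective; `b : ι → (T ⟶ X)` any family of morphisms. If `a^* c` lies in the sum over `i` of
the `bᵢ`-pull-backs of the span of the rational `(p,p)`-classes of `X`, then `c ∈ Nᵖ H²ᵖ(Z(ℂ))`.
[cite: Shioda1979PJA, §2 Thm. 1 and the list after it (p. 112)] [cite: Fulton1998, §19.2 Cor. 19.2 (b)]
[cite: VoisinHodgeI2002, §7.3.2 Remark 7.29] -/
theorem mem_algebraicClasses_of_fermatTransferFamily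
    (hF : hodgeClasses_algebraic_fermat) (hP : fulton1998_map_mem_algebraicClasses)
    (hm : m.Prime ∨ (1 < m ∧ m ≤ 20)) (hXF : IsFermatVariety k m X) (hX : IsSmoothProjective k X)
    (hZ : IsSmoothProjective z Z) (hT : IsSmoothProjective z T)
    (a : T ⟶ Z) [AlgebraicGeometry.Surjective a.left] (b : ι → (T ⟶ X))
    {c : complexBetti Z (2 * p)}
    (hc : complexBetti.map a (2 * p) c ∈ ⨆ i, (Submodule.span ℂ
        {x : complexBetti X (2 * p) | IsRationalClass x ∧ IsOfHodgeType k X (2 * p) p p x}).map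
          (complexBetti.map (b i) (2 * p)).hom) :
    c ∈ algebraicClasses Z p := by
  -- each summand consists of algebraic classes of `T`: Shioda on `X`, then Fulton along `b i`
  have hle : (⨆ i, (Submodule.span ℂ
      {x : complexBetti X (2 * p) | IsRationalClass x ∧ IsOfHodgeType k X (2 * p) p p x}).map
        (complexBetti.map (b i) (2 * p)).hom) ≤ algebraicClasses T p := by
    refine iSup_le fun i ↦ Submodule.map_le_iff_le_comap.2 fun x hx ↦ ?_
    exact hP (b i) hX hT p x ((Submodule.span_le.2 fun y hy ↦ hF hm hXF hX p y hy.1 hy.2) hx)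
  -- degree trick along the surjective equidimensional `a`
  exact mem_algebraicClasses_of_map_mem_of_surjective hT hZ a (hle hc)

/-- **The multi-domination principle on an abelian variety** (`Z = A`, smooth projective of dimension
`dim A`): the transfer of PROPOSITION T_m of the packet (`A = B` the primitive Prym of a Weil-type
`ℤ/m`-cover of `ℙ¹`, `T` over `C^{κh}`, `bᵢ = b_S` over the `h`-subsets `S`).
[cite: Shioda1979PJA, §2 Thm. 1 and the list after it (p. 112)] [cite: Fulton1998, §19.2 Cor. 19.2 (b)]
[cite: Schoen1988HodgeWeil, §1 Lemma 1.2 and §3 Cor. 3.1 (proof, pp. 24–25)] -/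
theorem abelianVariety_mem_algebraicClasses_of_fermatTransferFamily
    (hF : hodgeClasses_algebraic_fermat) (hP : fulton1998_map_mem_algebraicClasses)
    (A : Motives.AbelianVariety ℂ)
    (hm : m.Prime ∨ (1 < m ∧ m ≤ 20)) (hXF : IsFermatVariety k m X) (hX : IsSmoothProjective k X)
    (hT : IsSmoothProjective A.dim T) (a : T ⟶ A.X) [AlgebraicGeometry.Surjective a.left]
    (b : ι → (T ⟶ X)) {c : complexBetti A.X (2 * p)}
    (hc : complexBetti.map a (2 * p) c ∈ ⨆ i, (Submodule.span ℂ
        {x : complexBetti X (2 * p) | IsRationalClass x ∧ IsOfHodgeType k X (2 * p) p p x}).map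
          (complexBetti.map (b i) (2 * p)).hom) :
    c ∈ algebraicClasses A.X p :=
  mem_algebraicClasses_of_fermatTransferFamily hF hP hm hXF hX
    (Motives.AbelianVariety.isSmoothProjective_holds : IsSmoothProjective A.dim A.X) hT a b hc

end Principle

/-! ### §2 R3-shaped body (`WeilClassesCMField`) with a multi-datum -/

section Rthree

/-- **R3 on the multi-Fermat-dominated locus, from the two facts.** The body of `WeilClassesCMField`
(rung binders first and verbatim), then a multi-datum `(μ k, X = Xᵏ_μ, T, a, ι, b)` with `μ` prime or
`1 < μ ≤ 20`, `dim T = dim A`, `a` surjective, `b : ι → (T ⟶ X)`, then for every class of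
`weilClassesField A φ P (2m′)` with `a^* c ∈ ⨆ᵢ (bᵢ)^*(span of the rational (m′,m′)-classes of X)`: rational
of type `(m′,m′)` ⇒ algebraic. THEOREM F for `E = ℚ(ζ_μ)`, `φ(μ) > 2` (packet [P3-g37] 3.5) in the
transferred form that PROPOSITION T_m actually supplies. [cite: Shioda1979PJA, §2 Thm. 1 and the list after it (p. 112)]
[cite: Fulton1998, §19.2 Cor. 19.2 (b)] [cite: MoonenZarhin1998WeilClasses, §1] -/
theorem weilClassesCMField_fermatTransferFamily_of_facts
    (hF : hodgeClasses_algebraic_fermat) (hP : fulton1998_map_mem_algebraicClasses) :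
    ∀ (A : Motives.AbelianVariety ℂ) (φ : A ⟶ A) (P : Polynomial ℤ) (e m : ℕ),
      P.Monic → P.natDegree = e → 2 < e → Irreducible (P.map (Int.castRingHom ℚ)) →
      Polynomial.eval₂ (Int.castRingHom (CategoryTheory.End A)) (φ : CategoryTheory.End A) P = 0 →
      e * (2 * m) = 2 * A.dim →
      (∀ ρ : ℂ, Polynomial.eval₂ (Int.castRingHom ℂ) ρ P = 0 → starRingEnd ℂ ρ ≠ ρ) →
      (∃ Q : Polynomial ℚ, ∀ ρ : ℂ, Polynomial.eval₂ (Int.castRingHom ℂ) ρ P = 0 →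
          Polynomial.eval₂ (algebraMap ℚ ℂ) ρ Q = starRingEnd ℂ ρ) →
    ∀ (μ k : ℕ), μ.Prime ∨ (1 < μ ∧ μ ≤ 20) → ∀ (X T : Motives.SchemeOver ℂ),
      IsFermatVariety k μ X → IsSmoothProjective k X → IsSmoothProjective A.dim T →
    ∀ (a : T ⟶ A.X), AlgebraicGeometry.Surjective a.left → ∀ (ι : Type) (b : ι → (T ⟶ X)),
      ∀ c ∈ weilClassesField A φ P (2 * m),
        complexBetti.map a (2 * m) c ∈ (⨆ i, (Submodule.span ℂ
            {x : complexBetti X (2 * m) | IsRationalClass x ∧ IsOfHodgeType k X (2 * m) m m x}).map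
              (complexBetti.map (b i) (2 * m)).hom) →
        IsRationalClass c → IsOfHodgeType A.dim A.X (2 * m) m m c → c ∈ algebraicClasses A.X m := by
  intro A φ P e m _ _ _ _ _ _ _ _ μ k hμ X T hXF hX hT a ha ι b c _ hc _ _
  exact abelianVariety_mem_algebraicClasses_of_fermatTransferFamily hF hP A hμ hXF hX hT a b hc

/-- **The same body from the rung R3 itself** (`WeilClassesCMField`; the multi-datum is not used). -/
theorem weilClassesCMField_fermatTransferFamily_of_weilClassesCMField (h : WeilClassesCMField) :
    ∀ (A : Motives.AbelianVariety ℂ) (φ : A ⟶ A) (P : Polynomial ℤ) (e m : ℕ),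
      P.Monic → P.natDegree = e → 2 < e → Irreducible (P.map (Int.castRingHom ℚ)) →
      Polynomial.eval₂ (Int.castRingHom (CategoryTheory.End A)) (φ : CategoryTheory.End A) P = 0 →
      e * (2 * m) = 2 * A.dim →
      (∀ ρ : ℂ, Polynomial.eval₂ (Int.castRingHom ℂ) ρ P = 0 → starRingEnd ℂ ρ ≠ ρ) →
      (∃ Q : Polynomial ℚ, ∀ ρ : ℂ, Polynomial.eval₂ (Int.castRingHom ℂ) ρ P = 0 →
          Polynomial.eval₂ (algebraMap ℚ ℂ) ρ Q = starRingEnd ℂ ρ) →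
    ∀ (μ k : ℕ), μ.Prime ∨ (1 < μ ∧ μ ≤ 20) → ∀ (X T : Motives.SchemeOver ℂ),
      IsFermatVariety k μ X → IsSmoothProjective k X → IsSmoothProjective A.dim T →
    ∀ (a : T ⟶ A.X), AlgebraicGeometry.Surjective a.left → ∀ (ι : Type) (b : ι → (T ⟶ X)),
      ∀ c ∈ weilClassesField A φ P (2 * m),
        complexBetti.map a (2 * m) c ∈ (⨆ i, (Submodule.span ℂ
            {x : complexBetti X (2 * m) | IsRationalClass x ∧ IsOfHodgeType k X (2 * m) m m x}).map
              (complexBetti.map (b i) (2 * m)).hom) →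
        IsRationalClass c → IsOfHodgeType A.dim A.X (2 * m) m m c → c ∈ algebraicClasses A.X m := by
  intro A φ P e m hP1 hP2 hP3 hP4 hP5 hP6 hP7 hP8 _ _ _ _ _ _ _ _ _ _ _ _ c hcW _ hc hmm
  exact h A φ P e m hP1 hP2 hP3 hP4 hP5 hP6 hP7 hP8 c hcW hc hmm

/-- **On-path lemma**: the Hodge conjecture implies R3 on the multi-Fermat-dominated locus
(`HodgeConjecture → WeilClassesCMField →` the locus). -/
theorem weilClassesCMField_fermatTransferFamily_of_hodgeConjecture (h : _root_.HodgeConjecture) :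
    ∀ (A : Motives.AbelianVariety ℂ) (φ : A ⟶ A) (P : Polynomial ℤ) (e m : ℕ),
      P.Monic → P.natDegree = e → 2 < e → Irreducible (P.map (Int.castRingHom ℚ)) →
      Polynomial.eval₂ (Int.castRingHom (CategoryTheory.End A)) (φ : CategoryTheory.End A) P = 0 →
      e * (2 * m) = 2 * A.dim →
      (∀ ρ : ℂ, Polynomial.eval₂ (Int.castRingHom ℂ) ρ P = 0 → starRingEnd ℂ ρ ≠ ρ) →
      (∃ Q : Polynomial ℚ, ∀ ρ : ℂ, Polynomial.eval₂ (Int.castRingHom ℂ) ρ P = 0 →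
          Polynomial.eval₂ (algebraMap ℚ ℂ) ρ Q = starRingEnd ℂ ρ) →
    ∀ (μ k : ℕ), μ.Prime ∨ (1 < μ ∧ μ ≤ 20) → ∀ (X T : Motives.SchemeOver ℂ),
      IsFermatVariety k μ X → IsSmoothProjective k X → IsSmoothProjective A.dim T →
    ∀ (a : T ⟶ A.X), AlgebraicGeometry.Surjective a.left → ∀ (ι : Type) (b : ι → (T ⟶ X)),
      ∀ c ∈ weilClassesField A φ P (2 * m),
        complexBetti.map a (2 * m) c ∈ (⨆ i, (Submodule.span ℂ
            {x : complexBetti X (2 * m) | IsRationalClass x ∧ IsOfHodgeType k X (2 * m) m m x}).map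
              (complexBetti.map (b i) (2 * m)).hom) →
        IsRationalClass c → IsOfHodgeType A.dim A.X (2 * m) m m c → c ∈ algebraicClasses A.X m :=
  weilClassesCMField_fermatTransferFamily_of_weilClassesCMField (weilClassesCMField_of_hodgeConjecture h)

end Rthree

end Summit.HodgeConjecture.HodgeConjecture.WeilTypeLadder

end
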